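import Mathlib.Algebra.BigOperators.Expect
import Mathlib.Algebra.BigOperators.Fin
import Mathlib.Algebra.Field.ZMod
import Mathlib.Algebra.Order.BigOperators.Expect
import Mathlib.Analysis.SpecialFunctions.Pow.Real
import Mathlib.Data.Int.CardIntervalMod
import Mathlib.Tactic.LinearCombination
import HarnessLib

/-!
# Local input for the smooth linear forms estimate (Conlon–Fox–Zhao §9): periodic averaging and local densities

Trunk T-SIEVE. First bricks for the PROOFS of `SmoothLinearFormsEstimate` (CFZ Prop. 8.3,
file `GreenTao2008SmoothMajorant`), following §9 of D. Conlon, J. Fox, Y. Zhao, *The Green–Tao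
theorem: an exposition*, EMS Surv. 1 (2014) = arXiv:1403.2957 (held), p. 17:

"The width of the box `B` is at least `R^{10m}` in each dimension, so, by considering a slightly
smaller box `B' ⊆ B` such that each dimension of `B'` is divisible by `D ≤ R^{2m}`, we obtain
`E_{x ∈ B}[1_{d_j, d'_j ∣ θ_j(x) ∀ j}] = E_{x ∈ ℤ_D^t}[1_{d_j,d'_j ∣ θ_j(x) ∀ j}] + O(R^{-8m})`."

Proved here, for any `D`-periodic weight `g : ℤ_D^t → [0,1]` and any integer box
`B = ∏_j [a_j, a_j + ℓ_j)` with `ℓ_j ≥ D`: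
* `card_Ico_filter_intCast_eq`: an interval of length `D q` meets every residue class mod `D` in
  exactly `q` integers;
* `sum_box_comp_intCast_eq`, `expect_box_comp_intCast_eq`: on a box with sides `D q_j` the
  average of `g(x mod D)` is exactly the average of `g` over `ℤ_D^t`;
* `abs_expect_box_sub_expect_le`: for a general box, `|E_B[g(x mod D)] - E_{ℤ_D^t}[g]| ≤ ∑_j D/ℓ_j`
  (pass to the sub-box `B'` with sides `D ⌊ℓ_j/D⌋`; `|B ∖ B'|/|B| ≤ ∑_j D/ℓ_j`);
and the local densities of p. 17 ("When `p > w`, the expectation … equals `1` if all `d_j, d'_j`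
are `1`, `1/p` if `d_j d'_j = 1` for all except exactly one `j`, and is at most `1/p²` otherwise
(here we assume that `w` is sufficiently large so that no two `ψ_i` are multiples of each other
mod `p`)"; and `= 0` for `p ≤ w` by the `W`-trick), as counts of solutions in `ℤ_p^t` of affine
equations `∑_j c_{ij} x_j = d_i`:
* `card_affineHyperplane` (one equation with `c_i ≠ 0`: exactly `p^{t-1}` solutions),
* `card_two_affineHyperplanes_le` (two equations with an invertible `2 × 2` minor: at most
  `p^{t-2}` solutions), `card_solutions_mono`,
* `not_dvd_minor_of_abs_le` (integer rows that are not `ℚ`-proportional and have entries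
  `≤ B` in absolute value stay linearly independent mod every prime `p > 2B²`).

## References
* D. Conlon, J. Fox, Y. Zhao, EMS Surv. Math. Sci. 1 (2014), 249–282, §9 (p. 17: the display
  after (28) and the local factor computation before (34); printed display numbers). [cite: ConlonFoxZhao2014]
* B. Green, T. Tao, Ann. of Math. 167 (2008), Lemma 10.1 (the same local factor estimate).
  [cite: GreenTaoAnnals2008]
-/

noncomputable section

open Finset
open scoped BigOperators

namespace Literature.NumberTheory.Sieve.CFZ

/-! ### Residue classes in intervals and boxes -/

/-- An interval `[a, a + Dq)` contains exactly `q` integers in each residue class modulo `D`.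
[folklore] -/
theorem card_Ico_filter_intCast_eq {D : ℕ} [NeZero D] (a : ℤ) (q : ℕ) (y : ZMod D) :
    #((Ico a (a + D * q)).filter fun x : ℤ => (x : ZMod D) = y) = q := by
  have hD : 0 < D := Nat.pos_of_ne_zero (NeZero.ne D)
  have hv : ∀ x : ℤ, ((x : ZMod D) = y) ↔ x ≡ (y.val : ℤ) [ZMOD (D : ℤ)] := by
    intro x
    rw [← ZMod.intCast_eq_intCast_iff, Int.cast_natCast, ZMod.natCast_zmod_val]
  have hfilter : ((Ico a (a + D * q)).filter fun x : ℤ => (x : ZMod D) = y) =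
      (Ico a (a + D * q)).filter fun x : ℤ => x ≡ (y.val : ℤ) [ZMOD (D : ℤ)] :=
    filter_congr fun x _ => hv x
  rw [hfilter]
  have h := Int.Ico_filter_modEq_card a (a + D * q) (r := (D : ℤ)) (by exact_mod_cast hD) (y.val : ℤ)
  have hD' : (D : ℚ) ≠ 0 := by exact_mod_cast hD.ne'
  have hq : ⌈((a + D * q : ℤ) - (y.val : ℤ) : ℚ) / (D : ℤ)⌉ - ⌈((a : ℤ) - (y.val : ℤ) : ℚ) / (D : ℤ)⌉ = q := by
    have : ((a + D * q : ℤ) - (y.val : ℤ) : ℚ) / (D : ℤ) = ((a : ℤ) - (y.val : ℤ) : ℚ) / (D : ℤ) + (q : ℤ) := by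
      push_cast
      field_simp
      ring
    rw [this, Int.ceil_add_intCast]
    ring
  rw [hq] at h
  have h' : ((#((Ico a (a + D * q)).filter fun x : ℤ => x ≡ (y.val : ℤ) [ZMOD (D : ℤ)]) : ℤ)) = q := by
    rw [h]; simp
  exact_mod_cast h'

/-- Filtering a box coordinatewise. [folklore] -/
theorem filter_piFinset_eq {t : ℕ} {α : Type*} [DecidableEq α] (s : Fin t → Finset α)
    (p : Fin t → α → Prop) [∀ j, DecidablePred (p j)] :
    ((Fintype.piFinset s).filter fun x => ∀ j, p j (x j)) = Fintype.piFinset fun j => (s j).filter (p j) := by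
  ext x
  simp only [mem_filter, Fintype.mem_piFinset]
  constructor
  · rintro ⟨h1, h2⟩ j; exact ⟨h1 j, h2 j⟩
  · intro h; exact ⟨fun j => (h j).1, fun j => (h j).2⟩

/-- **Exact periodic averaging on a box with sides divisible by `D`**:
`∑_{x ∈ ∏_j [a_j, a_j + D q_j)} g(x mod D) = (∏_j q_j) ∑_{y ∈ ℤ_D^t} g(y)`.
[cite: ConlonFoxZhao2014, Section 9 (display after eq. 9.1)] -/
theorem sum_box_comp_intCast_eq {t D : ℕ} [NeZero D] (a : Fin t → ℤ) (q : Fin t → ℕ)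
    (g : (Fin t → ZMod D) → ℝ) :
    ∑ x ∈ Fintype.piFinset (fun j => Ico (a j) (a j + D * q j)), g (fun j => (x j : ZMod D)) =
      (∏ j, (q j : ℝ)) * ∑ y : Fin t → ZMod D, g y := by
  classical
  set B := Fintype.piFinset (fun j => Ico (a j) (a j + D * q j)) with hB
  set π : (Fin t → ℤ) → (Fin t → ZMod D) := fun x j => (x j : ZMod D) with hπ
  rw [← sum_fiberwise_of_maps_to (g := π) (t := (univ : Finset (Fin t → ZMod D))) (fun x _ => mem_univ _)]
  rw [mul_sum]
  refine sum_congr rfl fun y _ => ?_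
  have hfib : (B.filter fun x => π x = y) = Fintype.piFinset fun j =>
      (Ico (a j) (a j + D * q j)).filter fun xj : ℤ => (xj : ZMod D) = y j := by
    rw [← filter_piFinset_eq]
    refine filter_congr fun x _ => ?_
    simp only [hπ, funext_iff]
  have hconst : ∀ x ∈ B.filter (fun x => π x = y), g (π x) = g y := fun x hx => by rw [(mem_filter.1 hx).2]
  rw [sum_congr rfl hconst, sum_const, hfib, Fintype.card_piFinset, nsmul_eq_mul]
  congr 1
  rw [Nat.cast_prod]
  exact prod_congr rfl fun j _ => by rw [card_Ico_filter_intCast_eq]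

/-- The averaged form: `E_{x ∈ B'} g(x mod D) = E_{y ∈ ℤ_D^t} g(y)` for a box `B'` with sides
`D q_j`, `q_j ≥ 1`. [cite: ConlonFoxZhao2014, Section 9 (display after eq. 9.1)] -/
theorem expect_box_comp_intCast_eq {t D : ℕ} [NeZero D] (a : Fin t → ℤ) (q : Fin t → ℕ)
    (hq : ∀ j, 1 ≤ q j) (g : (Fin t → ZMod D) → ℝ) :
    𝔼 x ∈ Fintype.piFinset (fun j => Ico (a j) (a j + D * q j)), g (fun j => (x j : ZMod D)) =
      𝔼 y : Fin t → ZMod D, g y := by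
  classical
  have hD : 0 < D := Nat.pos_of_ne_zero (NeZero.ne D)
  have hcard : (#(Fintype.piFinset fun j => Ico (a j) (a j + D * q j)) : ℝ) =
      (D : ℝ) ^ t * ∏ j, (q j : ℝ) := by
    rw [Fintype.card_piFinset, Nat.cast_prod]
    rw [show (∏ j, (#(Ico (a j) (a j + D * q j)) : ℝ)) = ∏ j : Fin t, ((D : ℝ) * q j) from
      prod_congr rfl fun j _ => by
        rw [Int.card_Ico, add_sub_cancel_left, ← Nat.cast_mul, Int.toNat_natCast]; push_cast; ring]
    rw [prod_mul_distrib, prod_const, card_univ, Fintype.card_fin]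
  rw [expect_eq_sum_div_card, expect_eq_sum_div_card, sum_box_comp_intCast_eq, card_univ,
    Fintype.card_fun, ZMod.card, Fintype.card_fin, hcard]
  have hq0 : (0 : ℝ) < ∏ j, (q j : ℝ) := prod_pos fun j _ => by exact_mod_cast hq j
  have hD0 : (0 : ℝ) < (D : ℝ) ^ t := by positivity
  push_cast
  field_simp

/-! ### General boxes: pass to a sub-box with sides divisible by `D` -/

/-- `1 - ∑ ε_j ≤ ∏ (1 - ε_j)` for `ε_j ∈ [0,1]` (Weierstrass product inequality). [folklore] -/
theorem one_sub_sum_le_prod_one_sub {ι : Type*} (s : Finset ι) {ε : ι → ℝ} (h0 : ∀ i ∈ s, 0 ≤ ε i)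
    (h1 : ∀ i ∈ s, ε i ≤ 1) : 1 - ∑ i ∈ s, ε i ≤ ∏ i ∈ s, (1 - ε i) := by
  classical
  induction s using Finset.induction_on with
  | empty => simp
  | @insert a s ha ih =>
    rw [sum_insert ha, prod_insert ha]
    have h0' : ∀ i ∈ s, 0 ≤ ε i := fun i hi => h0 i (mem_insert_of_mem hi)
    have h1' : ∀ i ∈ s, ε i ≤ 1 := fun i hi => h1 i (mem_insert_of_mem hi)
    have ih' := ih h0' h1'
    have hP0 : 0 ≤ ∏ i ∈ s, (1 - ε i) := prod_nonneg fun i hi => sub_nonneg.2 (h1' i hi)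
    have hP1 : ∏ i ∈ s, (1 - ε i) ≤ 1 := prod_le_one (fun i hi => sub_nonneg.2 (h1' i hi))
      (fun i hi => sub_le_self _ (h0' i hi))
    have ha0 := h0 a (mem_insert_self a s)
    have ha1 := h1 a (mem_insert_self a s)
    nlinarith

/-- **Periodic averaging on a general box** (CFZ §9, p. 17): for a `D`-periodic weight
`g : ℤ_D^t → [0,1]` and an integer box `B = ∏_j [a_j, a_j + ℓ_j)` with `ℓ_j ≥ D`,
`|E_{x ∈ B} g(x mod D) - E_{ℤ_D^t} g| ≤ ∑_j D/ℓ_j` (compare with the sub-box `B'` of sides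
`D⌊ℓ_j/D⌋`, on which the average is exact; `|B ∖ B'| ≤ (∑_j D/ℓ_j) |B|`).
[cite: ConlonFoxZhao2014, Section 9 (display after eq. 9.1)] -/
theorem abs_expect_box_sub_expect_le {t D : ℕ} [NeZero D] (a : Fin t → ℤ) (ℓ : Fin t → ℕ)
    (hℓ : ∀ j, D ≤ ℓ j) (g : (Fin t → ZMod D) → ℝ) (hg0 : ∀ y, 0 ≤ g y) (hg1 : ∀ y, g y ≤ 1) :
    |(𝔼 x ∈ Fintype.piFinset (fun j => Ico (a j) (a j + ℓ j)), g (fun j => (x j : ZMod D))) -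
        𝔼 y : Fin t → ZMod D, g y| ≤ ∑ j, (D : ℝ) / ℓ j := by
  classical
  have hD : 0 < D := Nat.pos_of_ne_zero (NeZero.ne D)
  set q : Fin t → ℕ := fun j => ℓ j / D with hq_def
  have hq1 : ∀ j, 1 ≤ q j := fun j => Nat.div_pos (hℓ j) hD
  set B := Fintype.piFinset (fun j => Ico (a j) (a j + ℓ j)) with hB
  set B' := Fintype.piFinset (fun j => Ico (a j) (a j + D * q j)) with hB'
  have hsub : B' ⊆ B := Fintype.piFinset_subset _ _ fun j => Ico_subset_Ico le_rfl (by
    have h : D * q j ≤ ℓ j := Nat.mul_div_le (ℓ j) D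
    have h' : ((D * q j : ℕ) : ℤ) ≤ ℓ j := by exact_mod_cast h
    push_cast at h'
    linarith)
  -- cardinalities
  have hℓ0 : ∀ j, (0 : ℝ) < ℓ j := fun j => by exact_mod_cast lt_of_lt_of_le hD (hℓ j)
  have hcB : (#B : ℝ) = ∏ j, (ℓ j : ℝ) := by
    rw [hB, Fintype.card_piFinset, Nat.cast_prod]
    exact prod_congr rfl fun j _ => by rw [Int.card_Ico]; simp
  have hcB' : (#B' : ℝ) = ∏ j, ((D * q j : ℕ) : ℝ) := by
    rw [hB', Fintype.card_piFinset, Nat.cast_prod]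
    exact prod_congr rfl fun j _ => by
      rw [Int.card_Ico, add_sub_cancel_left, ← Nat.cast_mul, Int.toNat_natCast]
  have hB0 : (0 : ℝ) < #B := by rw [hcB]; exact prod_pos fun j _ => hℓ0 j
  have hB'0 : (0 : ℝ) < #B' := by
    rw [hcB']; exact prod_pos fun j _ => by exact_mod_cast Nat.mul_pos hD (hq1 j)
  -- the ratio |B'|/|B| ≥ 1 - ∑ D/ℓ_j
  have hratio : 1 - ∑ j, (D : ℝ) / ℓ j ≤ #B' / #B := by
    rw [hcB, hcB', ← prod_div_distrib]
    refine (one_sub_sum_le_prod_one_sub univ (fun j _ => by positivity)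
      (fun j _ => (div_le_one (hℓ0 j)).2 (by exact_mod_cast hℓ j))).trans ?_
    refine prod_le_prod (fun j _ => sub_nonneg.2 ((div_le_one (hℓ0 j)).2 (by exact_mod_cast hℓ j)))
      fun j _ => ?_
    -- 1 - D/ℓ ≤ (D q)/ℓ since ℓ < D q + D
    rw [sub_le_iff_le_add, ← add_div, one_le_div (hℓ0 j)]
    have : ℓ j ≤ D * q j + D := by
      have h1 := Nat.div_add_mod (ℓ j) D
      have h2 := Nat.mod_lt (ℓ j) hD
      simp only [hq_def]
      linarith
    exact_mod_cast this
  -- exact average on B'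
  have hexact : 𝔼 x ∈ B', g (fun j => (x j : ZMod D)) = 𝔼 y : Fin t → ZMod D, g y :=
    expect_box_comp_intCast_eq a q hq1 g
  -- compare E_B and E_B'
  set S := ∑ x ∈ B, g (fun j => (x j : ZMod D)) with hS
  set S' := ∑ x ∈ B', g (fun j => (x j : ZMod D)) with hS'
  have hSS' : S' ≤ S := sum_le_sum_of_subset_of_nonneg hsub fun _ _ _ => hg0 _
  have hdiff : S - S' ≤ #B - #B' := by
    rw [hS, hS', ← sum_sdiff hsub, add_sub_cancel_right]
    calc ∑ x ∈ B \ B', g (fun j => (x j : ZMod D)) ≤ ∑ _x ∈ B \ B', (1 : ℝ) := sum_le_sum fun _ _ => hg1 _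
      _ = #(B \ B') := by simp
      _ = #B - #B' := by rw [card_sdiff_of_subset hsub]; push_cast [Nat.cast_sub (card_le_card hsub)]; ring
  have hS'le : S' ≤ #B' := by
    calc S' ≤ ∑ _x ∈ B', (1 : ℝ) := sum_le_sum fun _ _ => hg1 _
      _ = #B' := by simp
  have hS'0 : 0 ≤ S' := sum_nonneg fun _ _ => hg0 _
  rw [← hexact, expect_eq_sum_div_card, expect_eq_sum_div_card, ← hS, ← hS']
  -- |S/|B| - S'/|B'|| ≤ 1 - |B'|/|B|
  have key : |S / #B - S' / #B'| ≤ 1 - #B' / #B := by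
    rw [abs_le]
    constructor
    · -- S/|B| ≥ S'/|B| = (S'/|B'|)(|B'|/|B|) ≥ S'/|B'| - (1 - |B'|/|B|)
      have h1 : S' / #B ≤ S / #B := div_le_div_of_nonneg_right hSS' hB0.le
      have h2 : S' / #B' * (#B' / #B) = S' / #B := by field_simp
      have h3 : S' / #B' ≤ 1 := (div_le_one hB'0).2 hS'le
      have hr1 : (#B' : ℝ) / #B ≤ 1 := (div_le_one hB0).2 (by exact_mod_cast card_le_card hsub)
      have h4 : S' / #B' * (1 - #B' / #B) ≤ 1 * (1 - #B' / #B) :=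
        mul_le_mul_of_nonneg_right h3 (sub_nonneg.2 hr1)
      nlinarith
    · -- S/|B| - S'/|B'| ≤ (S - S')/|B| + S'(1/|B| - 1/|B'|) ≤ (|B| - |B'|)/|B|
      have h1 : S / #B ≤ (S' + (#B - #B')) / #B := div_le_div_of_nonneg_right (by linarith) hB0.le
      have h2 : (S' + (#B - #B')) / #B = S' / #B + (1 - #B' / #B) := by field_simp
      have h3 : S' / #B ≤ S' / #B' := div_le_div_of_nonneg_left hS'0 hB'0 (by exact_mod_cast card_le_card hsub)
      linarith
  linarith


/-! ### Local densities: solutions of affine equations in `ℤ_p^t` -/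

section LocalDensities

variable {p : ℕ} [Fact p.Prime] {n : ℕ}

/-- Restriction of `x ∈ ℤ_p^{n+1}` to the coordinates other than `j₀`. [folklore] -/
theorem removeNth_injOn_affine (j₀ : Fin (n + 1)) (c : Fin (n + 1) → ZMod p) (hc : c j₀ ≠ 0)
    (d : ZMod p) :
    Set.InjOn (fun x : Fin (n + 1) → ZMod p => j₀.removeNth x)
      {x | ∑ j, c j * x j = d} := by
  intro x hx y hy hxy
  have hx' : c j₀ * x j₀ + ∑ j : Fin n, c (j₀.succAbove j) * x (j₀.succAbove j) = d := by
    have h := hx; rw [Set.mem_setOf_eq, Fin.sum_univ_succAbove _ j₀] at h; exact h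
  have hy' : c j₀ * y j₀ + ∑ j : Fin n, c (j₀.succAbove j) * y (j₀.succAbove j) = d := by
    have h := hy; rw [Set.mem_setOf_eq, Fin.sum_univ_succAbove _ j₀] at h; exact h
  have hrest : ∀ j : Fin n, x (j₀.succAbove j) = y (j₀.succAbove j) := fun j => by
    have := congrFun hxy j
    simpa [Fin.removeNth_apply] using this
  have hsum : ∑ j : Fin n, c (j₀.succAbove j) * x (j₀.succAbove j) =
      ∑ j : Fin n, c (j₀.succAbove j) * y (j₀.succAbove j) :=
    Fintype.sum_congr _ _ fun j => by rw [hrest j]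
  have h0 : c j₀ * x j₀ = c j₀ * y j₀ := by rw [hsum] at hx'; linear_combination hx' - hy'
  have hj : x j₀ = y j₀ := mul_left_cancel₀ hc h0
  rw [← Fin.insertNth_self_removeNth j₀ x, ← Fin.insertNth_self_removeNth j₀ y, hj]
  simp only at hxy
  rw [hxy]

/-- **One affine equation `∑_j c_j x_j = d` with `c ≠ 0` has exactly `p^{t-1}` solutions in
`ℤ_p^t`** (CFZ p. 17: the local density is "`1/p` if `d_j d'_j = 1` for all except exactly one
`j`"; Green–Tao Lemma 10.1: "`θ_j` uniformly covers `ℤ_p`"). [cite: ConlonFoxZhao2014, Section 9] -/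
theorem card_affineHyperplane (j₀ : Fin (n + 1)) (c : Fin (n + 1) → ZMod p) (hc : c j₀ ≠ 0)
    (d : ZMod p) :
    #((univ : Finset (Fin (n + 1) → ZMod p)).filter fun x => ∑ j, c j * x j = d) = p ^ n := by
  classical
  set S := (univ : Finset (Fin (n + 1) → ZMod p)).filter fun x => ∑ j, c j * x j = d with hS
  have hinj : Set.InjOn (fun x : Fin (n + 1) → ZMod p => j₀.removeNth x) ↑S := by
    refine (removeNth_injOn_affine j₀ c hc d).mono ?_
    intro x hx
    exact (mem_filter.1 (mem_coe.1 hx)).2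
  have himg : S.image (fun x : Fin (n + 1) → ZMod p => j₀.removeNth x) = univ := by
    refine eq_univ_of_forall fun y => mem_image.2 ?_
    -- extend `y` by solving for the `j₀`-th coordinate
    set a : ZMod p := (c j₀)⁻¹ * (d - ∑ j : Fin n, c (j₀.succAbove j) * y j) with ha
    refine ⟨j₀.insertNth a y, mem_filter.2 ⟨mem_univ _, ?_⟩, Fin.removeNth_insertNth _ _ _⟩
    rw [Fin.sum_univ_succAbove _ j₀]
    simp only [Fin.insertNth_apply_same, Fin.insertNth_apply_succAbove, ha]
    field_simp
    ring
  rw [← card_image_of_injOn hinj, himg, card_univ, Fintype.card_fun, ZMod.card, Fintype.card_fin]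

/-- More equations, fewer solutions. [folklore] -/
theorem card_solutions_mono {ι : Type*} {t : ℕ} (c : ι → Fin t → ZMod p) (d : ι → ZMod p)
    {X Y : Finset ι} (h : X ⊆ Y) :
    #((univ : Finset (Fin t → ZMod p)).filter fun x => ∀ i ∈ Y, ∑ j, c i j * x j = d i) ≤
      #((univ : Finset (Fin t → ZMod p)).filter fun x => ∀ i ∈ X, ∑ j, c i j * x j = d i) :=
  card_le_card (fun _ hx => mem_filter.2 ⟨mem_univ _, fun i hi => (mem_filter.1 hx).2 i (h hi)⟩)

/-- **Two affine equations with an invertible `2×2` minor (columns `j₀ ≠ j₁`) have at most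
`p^{t-2}` solutions in `ℤ_p^t`** (CFZ p. 17: "at most `1/p²` otherwise"; Green–Tao Lemma 10.1:
"the intersection of two skew affine subspaces"): two solutions agreeing off `{j₀, j₁}` coincide.
[cite: ConlonFoxZhao2014, Section 9] -/
theorem card_two_affineHyperplanes_le {t : ℕ} {j₀ j₁ : Fin t} (hj : j₀ ≠ j₁)
    (c c' : Fin t → ZMod p) (hdet : c j₀ * c' j₁ - c j₁ * c' j₀ ≠ 0) (d d' : ZMod p) :
    #((univ : Finset (Fin t → ZMod p)).filter fun x => ∑ j, c j * x j = d ∧ ∑ j, c' j * x j = d') ≤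
      p ^ (t - 2) := by
  classical
  set S := (univ : Finset (Fin t → ZMod p)).filter fun x => ∑ j, c j * x j = d ∧ ∑ j, c' j * x j = d'
    with hS
  set V := {j : Fin t // ¬(j = j₀ ∨ j = j₁)} with hV
  have hcardV : Fintype.card V = t - 2 := by
    have h2 : Fintype.card {j : Fin t // j = j₀ ∨ j = j₁} = 2 := by
      rw [Fintype.card_subtype,
        show (univ.filter fun j : Fin t => j = j₀ ∨ j = j₁) = {j₀, j₁} by ext j; simp, card_pair hj]
    simp only [hV, Fintype.card_subtype_compl, Fintype.card_fin, h2]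
  have hinj : Set.InjOn (fun x : Fin t → ZMod p => fun v : V => x v.1) ↑S := by
    intro x hx y hy hxy
    obtain ⟨hx1, hx2⟩ := (mem_filter.1 (mem_coe.1 hx)).2
    obtain ⟨hy1, hy2⟩ := (mem_filter.1 (mem_coe.1 hy)).2
    have hagree : ∀ j, ¬(j = j₀ ∨ j = j₁) → x j = y j := fun j hj' => by
      have := congrFun hxy ⟨j, hj'⟩
      simpa using this
    -- the differences satisfy the homogeneous `2×2` system
    have hE : ∀ e : Fin t → ZMod p, ∑ j, e j * (x j - y j) = e j₀ * (x j₀ - y j₀) + e j₁ * (x j₁ - y j₁) := by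
      intro e
      refine Fintype.sum_eq_add j₀ j₁ hj fun j hj' => ?_
      rw [hagree j (not_or.2 hj'), sub_self, mul_zero]
    have h1 : c j₀ * (x j₀ - y j₀) + c j₁ * (x j₁ - y j₁) = 0 := by
      rw [← hE c]
      simp only [mul_sub, sum_sub_distrib, hx1, hy1, sub_self]
    have h2 : c' j₀ * (x j₀ - y j₀) + c' j₁ * (x j₁ - y j₁) = 0 := by
      rw [← hE c']
      simp only [mul_sub, sum_sub_distrib, hx2, hy2, sub_self]
    have hδ₀ : (c j₀ * c' j₁ - c j₁ * c' j₀) * (x j₀ - y j₀) = 0 := by linear_combination c' j₁ * h1 - c j₁ * h2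
    have hδ₁ : (c j₀ * c' j₁ - c j₁ * c' j₀) * (x j₁ - y j₁) = 0 := by linear_combination c j₀ * h2 - c' j₀ * h1
    have e₀ : x j₀ = y j₀ := sub_eq_zero.1 ((mul_eq_zero.1 hδ₀).resolve_left hdet)
    have e₁ : x j₁ = y j₁ := sub_eq_zero.1 ((mul_eq_zero.1 hδ₁).resolve_left hdet)
    funext j
    by_cases hj' : j = j₀ ∨ j = j₁
    · rcases hj' with rfl | rfl
      · exact e₀
      · exact e₁
    · exact hagree j hj'
  calc #S ≤ #(univ : Finset (V → ZMod p)) :=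
        card_le_card_of_injOn _ (fun x _ => mem_coe.2 (mem_univ _)) hinj
    _ = p ^ (t - 2) := by rw [card_univ, Fintype.card_fun, ZMod.card, hcardV]

/-- **Non-proportional bounded integer rows stay independent modulo large primes** (CFZ p. 17:
"we assume that `w` is sufficiently large so that no two `ψ_i` are multiples of each other
mod `p`"; Green–Tao Lemma 10.1, with the bound `√(w(N))/2` on the coefficients): if `L' ≠ 0`,
`L` is not a rational multiple of `L'`, and all entries are `≤ B` in absolute value, then some
`2×2` minor `M = L_{j₀} L'_{j₁} - L_{j₁} L'_{j₀}` is a nonzero integer with `|M| ≤ 2B²`, hence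
nonzero modulo every prime `p > 2B²`. [cite: ConlonFoxZhao2014, Section 9] -/
theorem exists_minor_ne_zero {t : ℕ} (L L' : Fin t → ℤ) (hL' : L' ≠ 0)
    (hprop : ∀ c : ℚ, (fun j => (L j : ℚ)) ≠ c • fun j => (L' j : ℚ)) {B : ℕ}
    (hB : ∀ j, |L j| ≤ B) (hB' : ∀ j, |L' j| ≤ B) :
    ∃ j₀ j₁ : Fin t, j₀ ≠ j₁ ∧ L j₀ * L' j₁ - L j₁ * L' j₀ ≠ 0 ∧
      |L j₀ * L' j₁ - L j₁ * L' j₀| ≤ 2 * B ^ 2 := by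
  -- a column where `L'` is nonzero
  obtain ⟨j₀, hj₀⟩ : ∃ j₀, L' j₀ ≠ 0 := by
    by_contra h; push Not at h; exact hL' (funext h)
  -- if all minors with `j₀` vanished, `L` would be the multiple `(L j₀ / L' j₀) • L'`
  by_contra hall
  push Not at hall
  apply hprop ((L j₀ : ℚ) / L' j₀)
  funext j
  simp only [Pi.smul_apply, smul_eq_mul]
  have hbd : |L j * L' j₀ - L j₀ * L' j| ≤ 2 * B ^ 2 := by
    calc |L j * L' j₀ - L j₀ * L' j| ≤ |L j * L' j₀| + |L j₀ * L' j| := abs_sub _ _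
      _ ≤ B * B + B * B := by
          rw [abs_mul, abs_mul]
          exact add_le_add (mul_le_mul (hB j) (hB' j₀) (abs_nonneg _) (by positivity))
            (mul_le_mul (hB j₀) (hB' j) (abs_nonneg _) (by positivity))
      _ = 2 * B ^ 2 := by ring
  have hmin : L j * L' j₀ - L j₀ * L' j = 0 := by
    by_cases hjj : j = j₀
    · subst hjj; ring
    · by_contra hne
      exact absurd (hall j j₀ hjj hne) (not_lt.2 hbd)
  have hq : (L j : ℚ) * L' j₀ = L j₀ * L' j := by exact_mod_cast sub_eq_zero.1 hmin
  have hj₀' : (L' j₀ : ℚ) ≠ 0 := by exact_mod_cast hj₀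
  field_simp
  linarith

/-- The minor of `exists_minor_ne_zero` is a unit modulo every prime `p > 2B²`.
[cite: ConlonFoxZhao2014, Section 9] -/
theorem intCast_minor_ne_zero {M : ℤ} (hM : M ≠ 0) {B : ℕ} (hMB : |M| ≤ 2 * B ^ 2)
    (hp : 2 * B ^ 2 < p) : (M : ZMod p) ≠ 0 := by
  rw [Ne, ZMod.intCast_zmod_eq_zero_iff_dvd]
  intro hdvd
  have h1 : (p : ℤ) ≤ |M| := Int.le_of_dvd (abs_pos.2 hM) ((dvd_abs _ _).2 hdvd)
  have h2 : ((2 * B ^ 2 : ℕ) : ℤ) < p := by exact_mod_cast hp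
  push_cast at h2
  linarith

end LocalDensities


end Literature.NumberTheory.Sieve.CFZ
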